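import Literature.Topology.PlaneTopology.CircleHomeomorphExtension
import Literature.Topology.PlaneTopology.Schoenflies
import Literature.Topology.PlaneTopology.FourKnotLift
import Mathlib.Analysis.SpecialFunctions.Trigonometric.Bounds
import Mathlib.Algebra.Order.Round
import HarnessLib

/-!
# The cone (radial) homeomorphism of the plane over a circle homeomorphism given by a lift

Topic `Literature/Topology/PlaneTopology`.  For a lift `K : ℝ → ℝ` (continuous, strictly
increasing, `K (t + 1) = K t + 1`) with inverse lift `K'`, the circle homeomorphism
`turn t ↦ turn (K t)` (`circleOfLift K`, read off the tree's `CircleTwist.twist` on the circle of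
radius `2`) and its **radial (cone) extension** `ρ · turn t ↦ ρ · turn (K t)`
(`coneHomeomorph`, the tree's `Schoenflies.radialHomeomorph`): a norm-preserving homeomorphism of
`ℂ`.  If `K` is Lipschitz, the circle map is Lipschitz on the circle
(`lipschitzOnWith_circleOfLift`, chord–arc comparison `4|a - b| ≤ |turn a - turn b|` for
`|a - b| ≤ 1/2`) and the cone map is Lipschitz on `ℂ` (`lipschitzWith_radialExtend`).  With the
piecewise-affine four-knot lifts of `FourKnotLift.lean` this gives bi-Lipschitz homeomorphisms of
the closed disc moving four boundary points to four prescribed boundary points — the device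
placing the corners of a quad at the corner directions of a conformal square (general position in
Schramm–Smirnov's Theorem 1.7).

## References

* [folklore]; Ch. Pommerenke, *Boundary Behaviour of Conformal Maps* (1992), §2.3 (radial
  extension). [PommerenkeBBCM1992]
* O. Schramm, S. Smirnov, Ann. Probab. 39 (2011), proof of Thm. 1.7. [SchrammSmirnov2011]
-/

noncomputable section

open Set Metric Real Filter Complex
open scoped NNReal

namespace Literature.Topology.PlaneTopology

open CircleTwist Schoenflies

/-! ### Chord–arc comparison on the unit circle -/

/-- `turn` is `2π`-Lipschitz: `|turn a - turn b| ≤ 2π |a - b|`. [folklore] -/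
theorem norm_turn_sub_turn_le (a b : ℝ) : ‖turn a - turn b‖ ≤ 2 * π * |a - b| := by
  have e : Complex.exp (Complex.I * ((2 * π * (a - b) : ℝ) : ℂ)) = turn (a - b) := by
    rw [turn_eq, mul_comm]
  have h : turn a - turn b = turn b * (Complex.exp (Complex.I * ((2 * π * (a - b) : ℝ) : ℂ)) - 1) := by
    rw [e, mul_sub, mul_one, ← turn_add, show b + (a - b) = a by ring]
  rw [h, norm_mul, norm_turn, one_mul]
  refine (Real.norm_exp_I_mul_ofReal_sub_one_le).trans ?_
  rw [Real.norm_eq_abs, abs_mul, abs_of_pos (by positivity : (0 : ℝ) < 2 * π)]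

/-- **Chord–arc**: for `|a - b| ≤ 1/2`, `4 |a - b| ≤ |turn a - turn b|`. [folklore] -/
theorem four_mul_abs_sub_le_norm_turn_sub (a b : ℝ) (hab : |a - b| ≤ 1 / 2) :
    4 * |a - b| ≤ ‖turn a - turn b‖ := by
  have e : Complex.exp (Complex.I * ((2 * π * (a - b) : ℝ) : ℂ)) = turn (a - b) := by
    rw [turn_eq, mul_comm]
  have h : turn a - turn b = turn b * (Complex.exp (Complex.I * ((2 * π * (a - b) : ℝ) : ℂ)) - 1) := by
    rw [e, mul_sub, mul_one, ← turn_add, show b + (a - b) = a by ring]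
  rw [h, norm_mul, norm_turn, one_mul, Complex.norm_exp_I_mul_ofReal_sub_one,
    show 2 * π * (a - b) / 2 = π * (a - b) by ring, Real.norm_eq_abs, abs_mul, abs_two]
  -- `|sin (π d)| = sin (π |d|) ≥ (2/π) (π |d|) = 2 |d|`
  have hsin : |Real.sin (π * (a - b))| = Real.sin (π * |a - b|) := by
    rcases le_or_gt 0 (a - b) with h0 | h0
    · have hab' : a - b ≤ 1 / 2 := (le_abs_self _).trans hab
      rw [abs_of_nonneg h0, abs_of_nonneg (Real.sin_nonneg_of_nonneg_of_le_pi (by positivity)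
        (by nlinarith [Real.pi_pos]))]
    · have hab' : -(a - b) ≤ 1 / 2 := (neg_le_abs _).trans hab
      have hneg : 0 ≤ -(a - b) := by linarith
      rw [abs_of_neg h0, show π * (a - b) = -(π * (-(a - b))) by ring, Real.sin_neg, abs_neg,
        abs_of_nonneg (Real.sin_nonneg_of_nonneg_of_le_pi (by positivity) (by nlinarith [Real.pi_pos]))]
  rw [hsin]
  have hj := Real.mul_le_sin (x := π * |a - b|) (by positivity)
    (by nlinarith [Real.pi_pos, abs_nonneg (a - b)])
  have : 2 / π * (π * |a - b|) = 2 * |a - b| := by field_simp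
  linarith

/-- Any two points of the circle have lifts within `1/2` of each other. [folklore] -/
theorem exists_lifts_abs_sub_le {ζ ζ' : ℂ} (hζ : ‖ζ‖ = 1) (hζ' : ‖ζ'‖ = 1) :
    ∃ a b : ℝ, turn a = ζ ∧ turn b = ζ' ∧ |a - b| ≤ 1 / 2 := by
  obtain ⟨a, rfl⟩ := exists_turn_eq hζ
  obtain ⟨b₀, rfl⟩ := exists_turn_eq hζ'
  refine ⟨a, b₀ + round (a - b₀), rfl, by rw [turn_add_intCast], ?_⟩
  have := abs_sub_round (a - b₀)
  rwa [show a - (b₀ + round (a - b₀)) = a - b₀ - round (a - b₀) by ring]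

/-! ### The circle map of a lift -/

section Lift

variable {K K' : ℝ → ℝ} (hKc : Continuous K) (hKm : StrictMono K) (hK1 : ∀ t, K (t + 1) = K t + 1)
  (hKc' : Continuous K') (hK1' : ∀ t, K' (t + 1) = K' t + 1)
  (hinv : ∀ t, K' (K t) = t) (hinv' : ∀ t, K (K' t) = t)

/-- **The circle map of a lift**, `turn t ↦ turn (K t)`, as a map of `ℂ` (read off the twist on
the circle of radius `2`). [folklore] -/
def circleOfLift (K : ℝ → ℝ) (ζ : ℂ) : ℂ := (2 : ℂ)⁻¹ * twist K (2 * ζ)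

/-- `circleOfLift K (turn t) = turn (K t)`. [folklore] -/
theorem circleOfLift_turn (hK1 : ∀ t, K (t + 1) = K t + 1) (t : ℝ) :
    circleOfLift K (turn t) = turn (K t) := by
  unfold circleOfLift
  have := twist_polar_of_two_le (K := K) hK1 (ρ := 2) le_rfl t
  push_cast at this
  rw [this]; ring

/-- The circle map preserves the norm of unit vectors: it maps the circle to the circle. [folklore] -/
theorem mapsTo_circleOfLift : MapsTo (circleOfLift K) (sphere 0 1) (sphere 0 1) := by
  intro ζ hζ
  rw [mem_sphere_zero_iff_norm] at hζ ⊢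
  unfold circleOfLift
  rw [norm_mul, norm_inv, norm_twist, norm_mul, hζ]
  norm_num

include hKc hK1 in
/-- The circle map is continuous. [folklore] -/
theorem continuous_circleOfLift : Continuous (circleOfLift K) := by
  unfold circleOfLift
  exact continuous_const.mul ((continuous_twist hKc hK1).comp (continuous_const.mul continuous_id))

include hK1 hK1' hinv in
/-- Inverse lifts give inverse circle maps. [folklore] -/
theorem circleOfLift_circleOfLift {ζ : ℂ} (hζ : ζ ∈ sphere (0 : ℂ) 1) :
    circleOfLift K' (circleOfLift K ζ) = ζ := by
  obtain ⟨t, rfl⟩ := exists_turn_eq (mem_sphere_zero_iff_norm.1 hζ)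
  rw [circleOfLift_turn hK1, circleOfLift_turn hK1', hinv]

/-- **Lipschitz circle maps from Lipschitz lifts**: constant `π L / 2`. [folklore] -/
theorem lipschitzOnWith_circleOfLift (hK1 : ∀ t, K (t + 1) = K t + 1) {L : ℝ≥0}
    (hL : LipschitzWith L K) :
    LipschitzOnWith ((π / 2).toNNReal * L) (circleOfLift K) (sphere 0 1) := by
  refine LipschitzOnWith.of_dist_le_mul fun ζ hζ ζ' hζ' => ?_
  obtain ⟨a, b, rfl, rfl, hab⟩ := exists_lifts_abs_sub_le (mem_sphere_zero_iff_norm.1 hζ)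
    (mem_sphere_zero_iff_norm.1 hζ')
  rw [circleOfLift_turn hK1, circleOfLift_turn hK1, dist_eq_norm, dist_eq_norm]
  have h1 := norm_turn_sub_turn_le (K a) (K b)
  have h2 : |K a - K b| ≤ L * |a - b| := by
    have := hL.dist_le_mul a b; rwa [Real.dist_eq, Real.dist_eq] at this
  have h3 := four_mul_abs_sub_le_norm_turn_sub a b hab
  have hc : ((((π / 2).toNNReal * L : ℝ≥0) : ℝ)) = π / 2 * L := by
    rw [NNReal.coe_mul, Real.coe_toNNReal _ (by positivity)]
  rw [hc]
  calc ‖turn (K a) - turn (K b)‖ ≤ 2 * π * |K a - K b| := h1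
    _ ≤ 2 * π * (L * |a - b|) := mul_le_mul_of_nonneg_left h2 (by positivity)
    _ = π / 2 * L * (4 * |a - b|) := by ring
    _ ≤ π / 2 * L * ‖turn a - turn b‖ := mul_le_mul_of_nonneg_left h3 (by positivity)

end Lift

/-! ### Lipschitz radial extensions -/

/-- **The radial extension of a Lipschitz self-map of the circle is Lipschitz** (constant
`2M + 1`). [folklore] -/
theorem lipschitzWith_radialExtend {g : ℂ → ℂ} {M : ℝ≥0} (hg : MapsTo g (sphere 0 1) (sphere 0 1))
    (hL : LipschitzOnWith M g (sphere 0 1)) : LipschitzWith (2 * M + 1) (radialExtend g) := by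
  -- the key estimate for `0 < ‖w‖ ≤ ‖z‖`
  have key : ∀ z w : ℂ, w ≠ 0 → ‖w‖ ≤ ‖z‖ →
      ‖radialExtend g z - radialExtend g w‖ ≤ (2 * M + 1) * ‖z - w‖ := by
    intro z w hw hwz
    have hz : z ≠ 0 := by
      intro h; rw [h, norm_zero] at hwz; exact hw (norm_eq_zero.1 (le_antisymm hwz (norm_nonneg _)))
    have hzn : 0 < ‖z‖ := norm_pos_iff.2 hz
    have hwn : 0 < ‖w‖ := norm_pos_iff.2 hw
    set u : ℂ := (‖z‖ : ℂ)⁻¹ * z with hu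
    set v : ℂ := (‖w‖ : ℂ)⁻¹ * w with hv
    have hus : u ∈ sphere (0 : ℂ) 1 := inv_norm_mul_mem_sphere hz
    have hvs : v ∈ sphere (0 : ℂ) 1 := inv_norm_mul_mem_sphere hw
    have hgu : ‖g u‖ = 1 := mem_sphere_zero_iff_norm.1 (hg hus)
    -- `‖w‖ ‖u - v‖ ≤ 2 ‖z - w‖`
    have huv : ‖w‖ * ‖u - v‖ ≤ 2 * ‖z - w‖ := by
      have hw0 : (‖w‖ : ℂ) ≠ 0 := by exact_mod_cast hwn.ne'
      have e : (‖w‖ : ℂ) * (u - v) = ((‖w‖ / ‖z‖ : ℝ) : ℂ) * z - w := by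
        rw [hu, hv, mul_sub, ← mul_assoc (‖w‖ : ℂ) ((‖w‖ : ℂ)⁻¹) w, mul_inv_cancel₀ hw0, one_mul]
        push_cast; ring
      have hn : ‖w‖ * ‖u - v‖ = ‖((‖w‖ / ‖z‖ : ℝ) : ℂ) * z - w‖ := by
        rw [← e, norm_mul, Complex.norm_real, Real.norm_eq_abs, abs_norm]
      rw [hn]
      calc ‖((‖w‖ / ‖z‖ : ℝ) : ℂ) * z - w‖ ≤ ‖((‖w‖ / ‖z‖ : ℝ) : ℂ) * z - z‖ + ‖z - w‖ := norm_sub_le_norm_sub_add_norm_sub _ _ _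
        _ = (‖z‖ - ‖w‖) + ‖z - w‖ := by
            congr 1
            rw [show ((‖w‖ / ‖z‖ : ℝ) : ℂ) * z - z = (((‖w‖ / ‖z‖ - 1 : ℝ)) : ℂ) * z by push_cast; ring,
              norm_mul, Complex.norm_real, Real.norm_eq_abs, abs_of_nonpos (by
                rw [sub_nonpos, div_le_one hzn]; exact hwz)]
            field_simp
            ring
        _ ≤ ‖z - w‖ + ‖z - w‖ := by linarith [norm_sub_norm_le z w, abs_norm_sub_norm_le z w]
        _ = 2 * ‖z - w‖ := by ring
    have hguv : ‖g u - g v‖ ≤ M * ‖u - v‖ := by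
      have := hL.dist_le_mul u hus v hvs; rwa [dist_eq_norm, dist_eq_norm] at this
    calc ‖radialExtend g z - radialExtend g w‖
        = ‖((‖z‖ - ‖w‖ : ℝ) : ℂ) * g u + (‖w‖ : ℂ) * (g u - g v)‖ := by
          rw [radialExtend_eq, radialExtend_eq]; congr 1; push_cast; ring
      _ ≤ |‖z‖ - ‖w‖| * ‖g u‖ + ‖w‖ * ‖g u - g v‖ := by
          refine (norm_add_le _ _).trans ?_
          rw [norm_mul, norm_mul, Complex.norm_real, Complex.norm_real, Real.norm_eq_abs,
            Real.norm_eq_abs, abs_norm]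
      _ ≤ ‖z - w‖ + ‖w‖ * (M * ‖u - v‖) := by
          rw [hgu, mul_one]
          exact add_le_add (abs_norm_sub_norm_le z w) (mul_le_mul_of_nonneg_left hguv (norm_nonneg _))
      _ = ‖z - w‖ + M * (‖w‖ * ‖u - v‖) := by ring
      _ ≤ ‖z - w‖ + M * (2 * ‖z - w‖) := by gcongr
      _ = (2 * M + 1) * ‖z - w‖ := by ring
  refine LipschitzWith.of_dist_le_mul fun z w => ?_
  rw [dist_eq_norm, dist_eq_norm]
  push_cast
  rcases eq_or_ne w 0 with rfl | hw
  · rw [radialExtend_zero, sub_zero, sub_zero, norm_radialExtend hg]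
    have : 0 ≤ (M : ℝ) * ‖z‖ := by positivity
    nlinarith [norm_nonneg z]
  rcases eq_or_ne z 0 with rfl | hz
  · rw [radialExtend_zero, zero_sub, zero_sub, norm_neg, norm_neg, norm_radialExtend hg]
    have : 0 ≤ (M : ℝ) * ‖w‖ := by positivity
    nlinarith [norm_nonneg w]
  rcases le_total ‖w‖ ‖z‖ with h | h
  · exact key z w hw h
  · rw [norm_sub_rev, norm_sub_rev z w]; exact key w z hz h

/-! ### The cone homeomorphism of the four-knot lift -/

namespace FourKnots

variable (F : FourKnots)

/-- The circle map of the four-knot lift. [folklore] -/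
def circleMap : ℂ → ℂ := circleOfLift F.lift

/-- The circle map of the inverse lift. [folklore] -/
def circleMapInv : ℂ → ℂ := circleOfLift F.swap.lift

/-- `circleMap (turn t) = turn (K t)`. [folklore] -/
theorem circleMap_turn (t : ℝ) : F.circleMap (turn t) = turn (F.lift t) :=
  circleOfLift_turn F.lift_add_one t

/-- The circle map sends the knot `turn x_j` to `turn y_j`. [folklore] -/
theorem circleMap_turn_x (j : Fin 4) : F.circleMap (turn (F.x j)) = turn (F.y j) := by
  rw [circleMap_turn, lift_apply_x]

/-- **The cone homeomorphism** `ρ turn t ↦ ρ turn (K t)` of the four-knot data. [folklore] -/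
def coneHomeomorph : ℂ ≃ₜ ℂ :=
  radialHomeomorph (g := F.circleMap) (g' := F.circleMapInv)
    (continuous_circleOfLift F.continuous_lift F.lift_add_one).continuousOn mapsTo_circleOfLift
    (continuous_circleOfLift F.swap.continuous_lift F.swap.lift_add_one).continuousOn mapsTo_circleOfLift
    (fun _ hζ => circleOfLift_circleOfLift F.lift_add_one F.swap.lift_add_one F.lift_swap_lift hζ)
    (fun _ hζ => circleOfLift_circleOfLift F.swap.lift_add_one F.lift_add_one F.lift_lift_swap hζ)

/-- The cone homeomorphism is the radial extension of the circle map. [folklore] -/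
theorem coneHomeomorph_apply (z : ℂ) : F.coneHomeomorph z = radialExtend F.circleMap z := rfl

/-- The inverse cone homeomorphism is the cone homeomorphism of the swapped data. [folklore] -/
theorem coneHomeomorph_symm_apply (z : ℂ) : F.coneHomeomorph.symm z = radialExtend F.circleMapInv z := rfl

/-- **The cone homeomorphism preserves the norm.** [folklore] -/
theorem norm_coneHomeomorph (z : ℂ) : ‖F.coneHomeomorph z‖ = ‖z‖ :=
  norm_radialExtend mapsTo_circleOfLift z

/-- **Polar form**: `cone (ρ turn t) = ρ turn (K t)` for `ρ ≥ 0`. [folklore] -/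
theorem coneHomeomorph_polar {ρ : ℝ} (hρ : 0 ≤ ρ) (t : ℝ) :
    F.coneHomeomorph (ρ * turn t) = ρ * turn (F.lift t) := by
  rw [coneHomeomorph_apply, radialExtend_eq]
  have hn : ‖(ρ : ℂ) * turn t‖ = ρ := by rw [norm_mul, Complex.norm_real, Real.norm_eq_abs, abs_of_nonneg hρ, norm_turn, mul_one]
  rw [hn]
  rcases hρ.eq_or_lt with rfl | hρ'
  · simp
  · have : ((ρ : ℂ))⁻¹ * (ρ * turn t) = turn t := by
      rw [← mul_assoc, inv_mul_cancel₀ (by exact_mod_cast hρ'.ne'), one_mul]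
    rw [this, ← circleMap_turn]

/-- The cone homeomorphism maps the knot directions: `cone (ρ turn x_j) = ρ turn y_j`. [folklore] -/
theorem coneHomeomorph_knot {ρ : ℝ} (hρ : 0 ≤ ρ) (j : Fin 4) :
    F.coneHomeomorph (ρ * turn (F.x j)) = ρ * turn (F.y j) := by
  rw [coneHomeomorph_polar F hρ, lift_apply_x]

/-- The cone homeomorphism maps the open unit disc onto itself. [folklore] -/
theorem image_coneHomeomorph_ball : F.coneHomeomorph '' ball 0 1 = ball 0 1 :=
  image_ball_eq_of_norm_eq _ F.norm_coneHomeomorph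

/-- The cone homeomorphism maps the unit circle onto itself. [folklore] -/
theorem image_coneHomeomorph_sphere : F.coneHomeomorph '' sphere 0 1 = sphere 0 1 :=
  image_sphere_eq_of_norm_eq _ F.norm_coneHomeomorph

/-- **The cone homeomorphism is Lipschitz.** [folklore] -/
theorem lipschitzWith_coneHomeomorph :
    LipschitzWith (2 * ((π / 2).toNNReal * F.liftLip) + 1) F.coneHomeomorph := by
  have h := lipschitzWith_radialExtend (mapsTo_circleOfLift (K := F.lift))
    (lipschitzOnWith_circleOfLift F.lift_add_one F.lipschitzWith_lift)
  exact h

/-- **Its inverse is Lipschitz.** [folklore] -/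
theorem lipschitzWith_coneHomeomorph_symm :
    LipschitzWith (2 * ((π / 2).toNNReal * F.swap.liftLip) + 1) F.coneHomeomorph.symm := by
  have h := lipschitzWith_radialExtend (mapsTo_circleOfLift (K := F.swap.lift))
    (lipschitzOnWith_circleOfLift F.swap.lift_add_one F.swap.lipschitzWith_lift)
  exact h

/-- Each piece lies in the fundamental interval. [folklore] -/
theorem piece_subset (j : Fin 4) : Icc (F.xe j.castSucc) (F.xe j.succ) ⊆ Icc (F.x 0) (F.x 0 + 1) := by
  refine Icc_subset_Icc ?_ ?_
  · have := F.xe_mono.monotone (Fin.zero_le (Fin.castSucc j)); simpa using this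
  · have := F.xe_mono.monotone (Fin.le_last (Fin.succ j)); simpa using this

/-- On the closed fundamental interval the lift is the spline. [folklore] -/
theorem lift_eq_spline_of_mem_Icc {t : ℝ} (ht : t ∈ Icc (F.x 0) (F.x 0 + 1)) : F.lift t = F.spline t := by
  rcases ht.2.eq_or_lt with h | h
  · rw [h, F.lift_add_one, show F.lift (F.x 0) = F.y 0 from F.lift_apply_x 0]
    have h4 := F.spline_apply_xe 4
    simp only [xe_four, ye_four] at h4
    rw [h4]
  · exact F.lift_eq_spline ⟨ht.1, h⟩

/-- `cone (turn t) = turn (K t)`. [folklore] -/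
theorem coneHomeomorph_turn (t : ℝ) : F.coneHomeomorph (turn t) = turn (F.lift t) := by
  have := F.coneHomeomorph_polar zero_le_one t
  simpa using this

/-- **Arcs to arcs**: the cone homeomorphism maps the arc `{turn t | t ∈ [x_j, x_{j+1}]}` onto
`{turn t | t ∈ [y_j, y_{j+1}]}`. [folklore] -/
theorem image_coneHomeomorph_arc (j : Fin 4) :
    F.coneHomeomorph '' (turn '' Icc (F.xe j.castSucc) (F.xe j.succ)) =
      turn '' Icc (F.ye j.castSucc) (F.ye j.succ) := by
  ext w
  constructor
  · rintro ⟨z, ⟨t, ht, rfl⟩, rfl⟩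
    refine ⟨F.spline t, F.spline_mem_of_mem j ht, ?_⟩
    rw [coneHomeomorph_turn, F.lift_eq_spline_of_mem_Icc (F.piece_subset j ht)]
  · rintro ⟨u, hu, rfl⟩
    have hu' : u ∈ Icc (F.swap.xe j.castSucc) (F.swap.xe j.succ) := by simpa using hu
    have hsrc : F.swap.spline u ∈ Icc (F.xe j.castSucc) (F.xe j.succ) := by
      simpa using F.swap.spline_mem_of_mem j hu'
    have hmem : F.swap.spline u ∈ Icc (F.x 0) (F.x 0 + 1) := F.piece_subset j hsrc
    refine ⟨turn (F.swap.spline u), ⟨F.swap.spline u, hsrc, rfl⟩, ?_⟩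
    rw [coneHomeomorph_turn, F.lift_eq_spline_of_mem_Icc hmem]
    have key := F.swap.spline_swap_spline (t := u) (by simpa using F.swap.piece_subset j hu')
    rw [swap_swap] at key
    rw [key]

end FourKnots

end Literature.Topology.PlaneTopology

end
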